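import Summits.Ventures.HSemireg.Pad4TowerLineDesignCert10RuleD1
import Summits.Ventures.HSemireg.Pad4TowerLineDesignCert10RuleD2
import Summits.Ventures.HSemireg.Pad4TowerLineDesignCert10XPlus1
import Summits.Ventures.HSemireg.Pad4TowerLineDesignCert10XPlus2
import Summits.Ventures.HSemireg.Pad4TowerLineDesignCert10XPlus3
import Summits.Ventures.HSemireg.Pad4TowerLineDesignCert12

/-!
# Pad4Tower ∕ LineDesignCert10 — KERNEL CERTIFICATE (tree module set, the assembly): an explicit EVEN H₁-static G₁-closed first-order design at height 10 ON THE CEILING LINE carrying the phase-mixing fully-charged cell `P[8I+ℓ₋₁|8I+ℓ₋₁|8I+ℓ₁|8I+ℓ₁]` ⇒ `CellRealisable 10 false` for it (KERNEL), the LINE-realisable shape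

HONEST FRAMING. Typed and farm-checked by hsemireg-phasetorus-typer-1 g3 on plan-lens-HodgeAV-control g10's KEY (b) (bus l.10147: «LINE-10 TREE CERTIFICATE
`Pad4TowerLineDesignCert10` in the style of Cert8∕Cert12 … if a `decide` FAILS, that is a finding — report it, do not repair the witness»; none failed), crux of record
stmt-HodgeConjecture-18881 `BlochSeedDiscOne` (skeleton `Cruxes∕BlochSeedDiscOne∕Lines∕birth.lean` 814a6a70c14e831a UNTOUCHED). This module ASSEMBLES the kernel
certificate: **`c10_staticH1 : c10.StaticH1`**, `c10_g1Closed`, `c10_inDiamond : c10.InDiamond 10`, `c10_onLine` (every letter on `α + c = 10`), `c10_noOddFC` (EVEN),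
`am22_mem_upper : am22Cell ∈ c10.upper` with `am22Cell = mcellOf (9,-1,0) (9,-1,0) (9,1,0) (9,1,0)` = `P[8I+ℓ₋₁|8I+ℓ₋₁|8I+ℓ₁|8I+ℓ₁]` (fully charged, two antipodal
phases 2+2), hence **`am22_cellRealisable : CellRealisable 10 false am22Cell`** (and `_ge` at every `h ≥ 10`), the LINE-realisable shape `am22_lineRealisable_shape`
(= LINE 6's `LineRealisable 10 false` ∕ control g10's `DiamondLevelLaws.LineRealisable` unfolded; Cruxes modules are not importable, so it is stated by shape), and
`CellRealisable 10` for every cell of the support. READING (control's words, not mine): the machine row «type 0022 FC cell present at LINE-10: SAT» becomes a kernel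
fact — control g9's v1.9 falsifier (a) ∕ `¬ PureFCLine 10` side — and (LN₁₀) of `Cruxes∕BlochSeedDiscOne∕DiamondLevelLaws.lean` gets a third kernel witness; nothing
more. (T₁₀) («no ODD H₁-static G₁-closed design at ◇₁₀») is untouched: this design is EVEN.

WHAT IS CERTIFIED (all kernel): `c10.InDiamond 10` · every letter on `α + c = 10` · `c10.G1Closed` (`…Cert10Closure`) · `RuleDMu4Closed c10` (224 `N`-heads +
340 `P`-heads, `…Cert10RuleD1` ∕ `…RuleD2`) · `XPlusClosed c10` (through the literal dual `c10d = c10.dual 0` and the tree's guarded form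
`LineDesignCert12.xresXClosed_iff_guarded'`, 340 dual heads, `…Cert10XPlus1–3`) · `A2IMinusClosed c10` (by the tree's LINE LEMMA
`LineDesignCert12.a2iMinusClosed_of_onCeiling`: A2I⁻ is vacuous on a line support inside a diamond — no decide) ⇒ `c10_staticH1`; `¬ c10.HasOddFC`;
`am22Cell ∈ c10.upper`, `FCc am22Cell`, `am22Cell 0 ≠ am22Cell 2`.

PROVENANCE (one machine step, irrelevant to validity — the theorems hold for the lists AS WRITTEN): gs-eng-2 g55's RESIDUAL instrument at ◇₁₀
(j322459 STAGE C, row C-antimix22; `pub-hsemireg/general-structure/gs2/g55/residual/census.json` 54e0e087dcd02cd5, key `P[8I+l-1|8I+l-1|8I+l1|8I+l1]`, field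
`support` = `gs2/g55/residual/models/model-res-C-antimix22.txt` sha16 7811233cc7321645: «SAT support for P[8I+ℓ₋₁|8I+ℓ₋₁|8I+ℓ₁|8I+ℓ₁] present at ◇₁₀», 14 TRUE
G₁-orbit variables, every other orbit variable FALSE), named as the WITNESS OF RECORD by plan-lens-HodgeAV-control g10 (KEY (b), bus l.10147). The 14 representatives
`P[5ℓ₋₁|10I|10I|10I]`, `P[2I+4ℓ₋₁|8I+ℓ₁|10I|10I]`, `N[2I+4ℓ₋₁|10I|10I|10I]`, `P[4I+3ℓ₋₁|6I+2ℓ₁|10I|10I]`, `P[4I+3ℓ₋₁|8I+ℓ₋₁|10I|10I]`, `P[4I+3ℓ₋₁|8I+ℓ₁|8I+ℓ₁|10I]`, `N[4I+3ℓ₋₁|8I+ℓ₁|10I|10I]`,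
`N[4I+3ℓ₋₁|10I|10I|10I]`, `P[6I+2ℓ₋₁|6I+2ℓ₋₁|10I|10I]`, `P[6I+2ℓ₋₁|8I+ℓ₋₁|8I+ℓ₁|10I]`, `N[6I+2ℓ₋₁|8I+ℓ₋₁|10I|10I]`, `N[6I+2ℓ₋₁|8I+ℓ₁|10I|10I]`, **`P[8I+ℓ₋₁|8I+ℓ₋₁|8I+ℓ₁|8I+ℓ₁]`** (FC, the certified cell), `N[8I+ℓ₋₁|8I+ℓ₋₁|8I+ℓ₁|10I]`
— ALL letters on the line `α + c = 10` — were expanded under G₁ = ⟨Δ⟩ × S₄ (224 `N`-cells + 340 `P`-cells = 564 cells) and transcribed letter by letter with the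
negation lens's dictionary of record `gen_cert.py` (= anomaly lens a9 `mirror_peel.py` 56fa14f9d46397e6 `parse_letter`: `t·I + c·ℓ_φ ↦ (t + c, c·Re φ, c·Im φ)`,
`ℓ₁, ℓ_i, ℓ₋₁, ℓ₋ᵢ ↦ (1,0), (0,−1), (−1,0), (0,1)`; Δ = `(a,b₁,b₂) ↦ (a,−b₂,b₁)` = `Pad4TowerDeltaWindow.deltaPt`; dual-0 `(a,b₁,b₂) ↦ (−a,−b₁,−b₂)`), sorted by
`LineDesignCert12.key`, chunked 5 `N` ∕ 10 `P` ∕ 6 dual heads per literal — generator `make_tree10.py` (hsemireg-phasetorus-typer-1 g3) = negation g7's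
`make_tree12.py` (the Cert12 tree cut of record) with h = 10, this witness, EVEN mode and tree-level reuse of the generic lemmas of `LineDesignCert12`.

MODULE SET (tree cut of ONE certificate; one namespace `Summit.Ventures.HSemireg.Pad4Tower.LineDesignCert10`): `…Cert10DataN` ∕ `DataP` ∕ `DataPd` ∕ `DataNd` (the support and its literal
dual-0 world, DATA ONLY) → `…Cert10Closure` (key-chain `Nodup`, the design `c10`, the literal dual `c10d` and `c10_dual_eq`, ◇₁₀, the ceiling line, per-chunk
G₁ closure ⇒ `c10` is Δ- and S₄-closed) → `…Cert10RuleD1` ∕ `…Cert10RuleD2` ∕ `…Cert10XPlus1` ∕ `…Cert10XPlus2` ∕ `…Cert10XPlus3` (the RULE D (μ₄, M) resp. guarded X⁺ decides, a few heads per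
theorem, module boundaries set by the gate's build budget only) → `Pad4TowerLineDesignCert10` (assembly `c10_staticH1`; the EVEN word `¬ c10.HasOddFC`; the
certified FC cell `P[8I+ℓ₋₁|8I+ℓ₋₁|8I+ℓ₁|8I+ℓ₁]` of phase type 2+2 («antipodal mix») at the upper level ⇒ `CellRealisable 10 false`, the LINE-realisable shape,
every support cell's realisability). Generic reductions (`key`, `nodup_of_keys`, `swapClosed_of_gens`, `xresXClosed_iff_guarded'`, `a2iMinusClosed_of_onCeiling`)
are the TREE's (`Pad4TowerLineDesignCert12Closure` ∕ `Pad4TowerLineDesignCert12`), imported — nothing generic is re-declared.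

NOTHING IN THIS MODULE SET SAYS THAT HC ∕ HC_CM ∕ HC_AV ∕ H2 ∕ stmt-HodgeConjecture-18881 ∕ (T₈) ∕ (T₁₀) HOLDS OR FAILS (HC_CM is a displayed binder of
the ladder only); the certified statements concern the typed FIRST-ORDER static game (`RuleDMu4Closed`, `XPlusClosed`, `A2IMinusClosed` = `MConfig.StaticH1`)
of ONE explicit finite support — first order is necessary, not sufficient, for a seed; no σ, no seed, no census row; the design is EVEN (no odd fully-charged
cell), hence CONSISTENT with (T₁₀) and silent about it. `decide +kernel` only: NO `native_decide`, no `sorry`, no `axiom`, no `instance`, no notation, no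
Literature fact, no new `def … : Prop`.
-/

set_option linter.dupNamespace false

namespace Summit.Ventures.HSemireg.Pad4Tower.LineDesignCert10

open Summit.Ventures.HSemireg Summit.Ventures.HSemireg.Pad4Tower

set_option maxRecDepth 32768
set_option Elab.async false
set_option synthInstance.maxSize 8192
set_option synthInstance.maxHeartbeats 2000000
set_option maxHeartbeats 8000000

/-! ## §1 Generic reductions — the tree's: `LineDesignCert12.xresXClosed_iff_guarded'` (guarded X family), `LineDesignCert12.a2iMinusClosed_of_onCeiling` (A2I⁻ is vacuous on a line support in a diamond) -/

/-! ## §4 Assembly — the kernel modules' chunk theorems recombined along the list spines -/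

/-- the block of module `…Cert10RuleD1`, level `N` (chunks 1–45): conjunction of its chunk theorems along the list spine. -/
theorem ruleDN_RuleD1 : ∀ Z ∈ l10N_RuleD1, RuleDMu4N c10 Z := List.forall_mem_append.2 ⟨List.forall_mem_append.2 ⟨List.forall_mem_append.2 ⟨List.forall_mem_append.2 ⟨List.forall_mem_append.2 ⟨List.forall_mem_append.2 ⟨List.forall_mem_append.2 ⟨List.forall_mem_append.2 ⟨List.forall_mem_append.2 ⟨List.forall_mem_append.2 ⟨List.forall_mem_append.2 ⟨List.forall_mem_append.2 ⟨List.forall_mem_append.2 ⟨List.forall_mem_append.2 ⟨List.forall_mem_append.2 ⟨List.forall_mem_append.2 ⟨List.forall_mem_append.2 ⟨List.forall_mem_append.2 ⟨List.forall_mem_append.2 ⟨List.forall_mem_append.2 ⟨List.forall_mem_append.2 ⟨List.forall_mem_append.2 ⟨List.forall_mem_append.2 ⟨List.forall_mem_append.2 ⟨List.forall_mem_append.2 ⟨List.forall_mem_append.2 ⟨List.forall_mem_append.2 ⟨List.forall_mem_append.2 ⟨List.forall_mem_append.2 ⟨List.forall_mem_append.2 ⟨List.forall_mem_append.2 ⟨List.forall_mem_append.2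 ⟨List.forall_mem_append.2 ⟨List.forall_mem_append.2 ⟨List.forall_mem_append.2 ⟨List.forall_mem_append.2 ⟨List.forall_mem_append.2 ⟨List.forall_mem_append.2 ⟨List.forall_mem_append.2 ⟨List.forall_mem_append.2 ⟨List.forall_mem_append.2 ⟨List.forall_mem_append.2 ⟨List.forall_mem_append.2 ⟨List.forall_mem_append.2 ⟨ruleDN_1, ruleDN_2⟩, ruleDN_3⟩, ruleDN_4⟩, ruleDN_5⟩, ruleDN_6⟩, ruleDN_7⟩, ruleDN_8⟩, ruleDN_9⟩, ruleDN_10⟩, ruleDN_11⟩, ruleDN_12⟩, ruleDN_13⟩, ruleDN_14⟩, ruleDN_15⟩, ruleDN_16⟩, ruleDN_17⟩, ruleDN_18⟩, ruleDN_19⟩, ruleDN_20⟩, ruleDN_21⟩, ruleDN_22⟩, ruleDN_23⟩, ruleDN_24⟩, ruleDN_25⟩, ruleDN_26⟩, ruleDN_27⟩, ruleDN_28⟩, ruleDN_29⟩, ruleDN_30⟩, ruleDN_31⟩, ruleDN_32⟩, ruleDN_33⟩, ruleDN_34⟩, ruleDN_35⟩, ruleDN_36⟩, ruleDN_37⟩,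 ruleDN_38⟩, ruleDN_39⟩, ruleDN_40⟩, ruleDN_41⟩, ruleDN_42⟩, ruleDN_43⟩, ruleDN_44⟩, ruleDN_45⟩
/-- the block of module `…Cert10RuleD2`, level `P` (chunks 1–34): conjunction of its chunk theorems along the list spine. -/
theorem ruleDP_RuleD2 : ∀ P ∈ l10P_RuleD2, RuleDMu4P c10 P := List.forall_mem_append.2 ⟨List.forall_mem_append.2 ⟨List.forall_mem_append.2 ⟨List.forall_mem_append.2 ⟨List.forall_mem_append.2 ⟨List.forall_mem_append.2 ⟨List.forall_mem_append.2 ⟨List.forall_mem_append.2 ⟨List.forall_mem_append.2 ⟨List.forall_mem_append.2 ⟨List.forall_mem_append.2 ⟨List.forall_mem_append.2 ⟨List.forall_mem_append.2 ⟨List.forall_mem_append.2 ⟨List.forall_mem_append.2 ⟨List.forall_mem_append.2 ⟨List.forall_mem_append.2 ⟨List.forall_mem_append.2 ⟨List.forall_mem_append.2 ⟨List.forall_mem_append.2 ⟨List.forall_mem_append.2 ⟨List.forall_mem_append.2 ⟨List.forall_mem_append.2 ⟨List.forall_mem_append.2 ⟨List.forall_mem_append.2 ⟨List.forall_mem_append.2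 ⟨List.forall_mem_append.2 ⟨List.forall_mem_append.2 ⟨List.forall_mem_append.2 ⟨List.forall_mem_append.2 ⟨List.forall_mem_append.2 ⟨List.forall_mem_append.2 ⟨List.forall_mem_append.2 ⟨ruleDP_1, ruleDP_2⟩, ruleDP_3⟩, ruleDP_4⟩, ruleDP_5⟩, ruleDP_6⟩, ruleDP_7⟩, ruleDP_8⟩, ruleDP_9⟩, ruleDP_10⟩, ruleDP_11⟩, ruleDP_12⟩, ruleDP_13⟩, ruleDP_14⟩, ruleDP_15⟩, ruleDP_16⟩, ruleDP_17⟩, ruleDP_18⟩, ruleDP_19⟩, ruleDP_20⟩, ruleDP_21⟩, ruleDP_22⟩, ruleDP_23⟩, ruleDP_24⟩, ruleDP_25⟩, ruleDP_26⟩, ruleDP_27⟩, ruleDP_28⟩, ruleDP_29⟩, ruleDP_30⟩, ruleDP_31⟩, ruleDP_32⟩, ruleDP_33⟩, ruleDP_34⟩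
/-- the block of module `…Cert10XPlus1`, level X⁺ (dual heads) (chunks 1–19): conjunction of its chunk theorems along the list spine. -/
theorem xplus_XPlus1 : ∀ Z ∈ l10Pd_XPlus1, ∀ σ : Fin 4, ¬ isApex (Z σ) → ∀ u : Fin 4, ∀ q ∈ s10Nd, UPartner Z q σ u → ∀ w : Fin 4, ∀ n ∈ s10Pd,
    Sibling q n σ w → ∀ f : Fin 4, ¬ XresXFires c10d Z q n σ u w f := List.forall_mem_append.2 ⟨List.forall_mem_append.2 ⟨List.forall_mem_append.2 ⟨List.forall_mem_append.2 ⟨List.forall_mem_append.2 ⟨List.forall_mem_append.2 ⟨List.forall_mem_append.2 ⟨List.forall_mem_append.2 ⟨List.forall_mem_append.2 ⟨List.forall_mem_append.2 ⟨List.forall_mem_append.2 ⟨List.forall_mem_append.2 ⟨List.forall_mem_append.2 ⟨List.forall_mem_append.2 ⟨List.forall_mem_append.2 ⟨List.forall_mem_append.2 ⟨List.forall_mem_append.2 ⟨List.forall_mem_append.2 ⟨xplus_1, xplus_2⟩, xplus_3⟩, xplus_4⟩, xplus_5⟩, xplus_6⟩, xplus_7⟩, xplus_8⟩, xplus_9⟩,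 xplus_10⟩, xplus_11⟩, xplus_12⟩, xplus_13⟩, xplus_14⟩, xplus_15⟩, xplus_16⟩, xplus_17⟩, xplus_18⟩, xplus_19⟩
/-- the block of module `…Cert10XPlus2`, level X⁺ (dual heads) (chunks 20–38): conjunction of its chunk theorems along the list spine. -/
theorem xplus_XPlus2 : ∀ Z ∈ l10Pd_XPlus2, ∀ σ : Fin 4, ¬ isApex (Z σ) → ∀ u : Fin 4, ∀ q ∈ s10Nd, UPartner Z q σ u → ∀ w : Fin 4, ∀ n ∈ s10Pd,
    Sibling q n σ w → ∀ f : Fin 4, ¬ XresXFires c10d Z q n σ u w f := List.forall_mem_append.2 ⟨List.forall_mem_append.2 ⟨List.forall_mem_append.2 ⟨List.forall_mem_append.2 ⟨List.forall_mem_append.2 ⟨List.forall_mem_append.2 ⟨List.forall_mem_append.2 ⟨List.forall_mem_append.2 ⟨List.forall_mem_append.2 ⟨List.forall_mem_append.2 ⟨List.forall_mem_append.2 ⟨List.forall_mem_append.2 ⟨List.forall_mem_append.2 ⟨List.forall_mem_append.2 ⟨List.forall_mem_append.2 ⟨List.forall_mem_append.2 ⟨List.forall_mem_append.2 ⟨List.forall_mem_append.2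 ⟨xplus_20, xplus_21⟩, xplus_22⟩, xplus_23⟩, xplus_24⟩, xplus_25⟩, xplus_26⟩, xplus_27⟩, xplus_28⟩, xplus_29⟩, xplus_30⟩, xplus_31⟩, xplus_32⟩, xplus_33⟩, xplus_34⟩, xplus_35⟩, xplus_36⟩, xplus_37⟩, xplus_38⟩
/-- the block of module `…Cert10XPlus3`, level X⁺ (dual heads) (chunks 39–57): conjunction of its chunk theorems along the list spine. -/
theorem xplus_XPlus3 : ∀ Z ∈ l10Pd_XPlus3, ∀ σ : Fin 4, ¬ isApex (Z σ) → ∀ u : Fin 4, ∀ q ∈ s10Nd, UPartner Z q σ u → ∀ w : Fin 4, ∀ n ∈ s10Pd,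
    Sibling q n σ w → ∀ f : Fin 4, ¬ XresXFires c10d Z q n σ u w f := List.forall_mem_append.2 ⟨List.forall_mem_append.2 ⟨List.forall_mem_append.2 ⟨List.forall_mem_append.2 ⟨List.forall_mem_append.2 ⟨List.forall_mem_append.2 ⟨List.forall_mem_append.2 ⟨List.forall_mem_append.2 ⟨List.forall_mem_append.2 ⟨List.forall_mem_append.2 ⟨List.forall_mem_append.2 ⟨List.forall_mem_append.2 ⟨List.forall_mem_append.2 ⟨List.forall_mem_append.2 ⟨List.forall_mem_append.2 ⟨List.forall_mem_append.2 ⟨List.forall_mem_append.2 ⟨List.forall_mem_append.2 ⟨xplus_39, xplus_40⟩, xplus_41⟩, xplus_42⟩, xplus_43⟩, xplus_44⟩, xplus_45⟩, xplus_46⟩, xplus_47⟩, xplus_48⟩, xplus_49⟩, xplus_50⟩, xplus_51⟩, xplus_52⟩, xplus_53⟩, xplus_54⟩, xplus_55⟩, xplus_56⟩, xplus_57⟩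
/-- RULE D at every `N`-cell. -/
theorem ruleDN_all : ∀ Z ∈ l10N, RuleDMu4N c10 Z := ruleDN_RuleD1
/-- RULE D at every `P`-cell. -/
theorem ruleDP_all : ∀ P ∈ l10P, RuleDMu4P c10 P := ruleDP_RuleD2
/-- **RULE D (μ₄, M) closed.** -/
theorem c10_ruleDMu4Closed : RuleDMu4Closed c10 := ⟨fun Z hZ => ruleDN_all Z hZ, fun P hP => ruleDP_all P hP⟩
/-- guarded X⁺ at every dual head. -/
theorem xplus_all : ∀ Z ∈ l10Pd, ∀ σ : Fin 4, ¬ isApex (Z σ) → ∀ u : Fin 4, ∀ q ∈ s10Nd, UPartner Z q σ u → ∀ w : Fin 4, ∀ n ∈ s10Pd,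
    Sibling q n σ w → ∀ f : Fin 4, ¬ XresXFires c10d Z q n σ u w f := List.forall_mem_append.2 ⟨List.forall_mem_append.2 ⟨xplus_XPlus1, xplus_XPlus2⟩, xplus_XPlus3⟩
/-- **X⁺ closed** (the literal dual world `c10d = c10.dual 0` bridges by `c10_dual_eq`; guarded form = the tree's `LineDesignCert12.xresXClosed_iff_guarded'`). -/
theorem c10_xPlusClosed : XPlusClosed c10 := by
  have hx : XresXClosed c10d := (LineDesignCert12.xresXClosed_iff_guarded' c10d).2 fun Z hZ => xplus_all Z hZ
  show XresXClosed (c10.dual 0)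
  rw [c10_dual_eq]; exact hx
/-- **A2I⁻ closed** — by the tree's LINE LEMMA `LineDesignCert12.a2iMinusClosed_of_onCeiling` (no decide). -/
theorem c10_a2iMinusClosed : A2IMinusClosed c10 :=
  LineDesignCert12.a2iMinusClosed_of_onCeiling c10 10 c10_inDiamond (fun Z hZ => l10N_onLine Z hZ) (fun P hP => l10P_onLine P hP)
/-- **THE DESIGN IS H₁-STATIC.** -/
theorem c10_staticH1 : c10.StaticH1 := ⟨c10_ruleDMu4Closed, c10_xPlusClosed, c10_a2iMinusClosed⟩

/-! ## §5 Consequences (kernel): the design is EVEN; the antipodal 2+2 FC cell `P[8I+ℓ₋₁|8I+ℓ₋₁|8I+ℓ₁|8I+ℓ₁]` is REALISABLE at ◇₁₀ on the line -/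

/-- no cell of the lists is odd fully charged. [kernel `decide`] -/
theorem c10_noOddFC_lists : (∀ Z ∈ l10N, ¬ (FCc Z ∧ OddPat Z.pat)) ∧ ∀ P ∈ l10P, ¬ (FCc P ∧ OddPat P.pat) := by constructor <;> decide +kernel
/-- **THE DESIGN IS EVEN**: no odd fully-charged cell (consistent with (T₁₀); says nothing about it). -/
theorem c10_noOddFC : ¬ c10.HasOddFC := by
  rintro (⟨Z, hZ, h⟩ | ⟨P, hP, h⟩)
  · exact c10_noOddFC_lists.1 Z hZ h
  · exact c10_noOddFC_lists.2 P hP h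
/-- the certified cell `P[8I+ℓ₋₁|8I+ℓ₋₁|8I+ℓ₁|8I+ℓ₁]` (unit letters of the two ANTIPODAL phases `ℓ₋₁`, `ℓ₁`, two each: phase type 2+2). -/
def am22Cell : MCell := mcellOf (9, -1, 0) (9, -1, 0) (9, 1, 0) (9, 1, 0)
/-- the certified cell is in the `P` list. [kernel `decide`] -/
theorem am22_mem : am22Cell ∈ l10P := by decide +kernel
/-- the certified cell is FULLY CHARGED, lies in ◇₁₀ with all letters on the line `α + c = 10`, and MIXES phases (letters 0 and 2 differ): it is not a one-phase («pure») FC cell. [kernel `decide`] -/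
theorem am22_fc : FCc am22Cell ∧ MCell.InDiamond 10 am22Cell ∧ (∀ f, OnCeiling 10 (am22Cell f)) ∧ am22Cell 0 ≠ am22Cell 2 := by
  refine ⟨?_, ?_, ?_, ?_⟩ <;> decide +kernel
/-- the certified cell is present at level `P` of `c10`. -/
theorem am22_mem_upper : am22Cell ∈ c10.upper := am22_mem
/-- **`P[8I+ℓ₋₁|8I+ℓ₋₁|8I+ℓ₁|8I+ℓ₁]` IS REALISABLE AT ◇₁₀** (`Pad4TowerB1OddBoostBlind.CellRealisable 10 false`; formerly the machine datum «C-antimix22 SAT at ◇₁₀», g55 residual census 54e0e087dcd02cd5). -/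
theorem am22_cellRealisable : CellRealisable 10 false am22Cell := ⟨c10, c10_inDiamond, c10_g1Closed, c10_staticH1, by simpa using am22_mem_upper⟩
/-- … hence at every height `h ≥ 10`. -/
theorem am22_cellRealisable_ge {h : ℤ} (hh : 10 ≤ h) : CellRealisable h false am22Cell := cellRealisable_mono hh am22_cellRealisable
/-- the LINE-realisable shape (LINE 6 `LineRealisable 10 false am22Cell` ∕ control g10's `DiamondLevelLaws.LineRealisable`, unfolded — Cruxes modules are not importable, so it is
stated by shape): an H₁-static G₁-closed ◇₁₀ support ON THE LINE `α + c = 10` carries the phase-mixing FC cell `P[8I+ℓ₋₁|8I+ℓ₋₁|8I+ℓ₁|8I+ℓ₁]` at level `P`. This is the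
tree-level witness control g9∕g10 name for «type 0022 FC present at LINE-10» (v1.9 falsifier (a) of `Cruxes∕BlochSeedDiscOne∕LinePhaseRigidity.lean`: `¬ PureFCLine 10`). -/
theorem am22_lineRealisable_shape : ∃ C : MConfig, C.InDiamond 10 ∧ ((∀ Z ∈ C.lower, ∀ f, OnCeiling 10 (Z f)) ∧ ∀ P ∈ C.upper, ∀ f, OnCeiling 10 (P f)) ∧
    C.G1Closed ∧ C.StaticH1 ∧ ¬ C.HasOddFC ∧ am22Cell ∈ C.upper ∧ FCc am22Cell ∧ am22Cell 0 ≠ am22Cell 2 :=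
  ⟨c10, c10_inDiamond, c10_onLine, c10_g1Closed, c10_staticH1, c10_noOddFC, am22_mem_upper, am22_fc.1, am22_fc.2.2.2⟩
/-- every cell of the lower level is REALISABLE at ◇₁₀ (`Pad4TowerB1OddBoostBlind.CellRealisable 10 true`). -/
theorem lower_cellRealisable {Z : MCell} (hZ : Z ∈ l10N) : CellRealisable 10 true Z := ⟨c10, c10_inDiamond, c10_g1Closed, c10_staticH1, by simpa using mem_lower_iff.mpr hZ⟩
/-- every cell of the upper level is REALISABLE at ◇₁₀ (`Pad4TowerB1OddBoostBlind.CellRealisable 10 false`). -/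
theorem upper_cellRealisable {P : MCell} (hP : P ∈ l10P) : CellRealisable 10 false P := ⟨c10, c10_inDiamond, c10_g1Closed, c10_staticH1, by simpa using mem_upper_iff.mpr hP⟩

end Summit.Ventures.HSemireg.Pad4Tower.LineDesignCert10
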